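import Literature.AlgebraicGeometry.HodgeTheory.ComplexBettiKunneth
import Literature.AlgebraicGeometry.Motives.UnramifiedCohomology
import HarnessLib

/-!
# Cross products and generic divisibility on a product `Y ⊗ Z` (integral Künneth, product descent)

Let `Y`, `Z` be smooth projective over `ℂ`, `(Y ⊗ Z)(ℂ) ≃ₜ Y(ℂ) × Z(ℂ)` (Conrad 2012 Prop. 2.1,
the tree's `AlgPoints.prodEquiv`), and `A` a commutative coefficient ring. Two Hodge-free facts
about the behaviour of cross products `pr_Y^* a ⌣ pr_Z^* b ∈ Hᵏ((Y ⊗ Z)(ℂ); A)` under restriction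
to the complex points of product Zariski opens `(Y ∖ S) × (Z ∖ T)`:

* **Integral Künneth for `(Y ⊗ Z)(ℂ)`** (`singularCohomology_lhMap_bijective_tensor`,
  `exists_eq_sum_cross_tensor`): for ANY coefficient ring `A` and classes
  `eⱼ ∈ H^{d j}(Z(ℂ); A)` forming a graded basis in the Leray–Hirsch sense (e.g. `A = ℤ` and
  `H^*(Z(ℂ); ℤ)` free of finite rank in each degree: curves, projective spaces, …), the map
  `(aⱼ) ↦ Σⱼ pr_Y^* aⱼ ⌣ pr_Z^* eⱼ : Π_{d j ≤ k} H^{k - d j}(Y(ℂ); A) → Hᵏ((Y ⊗ Z)(ℂ); A)` is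
  bijective (Hatcher Thm. 3.15/3.16: `H*(Y × Z)` is a free `H*(Y)`-module on the `pr_Z^* eⱼ`; the
  tree's `LerayHirsch.bijective_lhMap_fst_prod`, transported along `prodEquiv` exactly as in the
  field case `ComplexBettiKunneth`); in particular every class is such a sum.
* **Product descent of generic divisibility** (`restrictToCompl_cupProduct_cross`,
  `preimage_fst_union_preimage_snd_ne_univ`, `isClosed_iUnion_and_iUnion_ne_univ`,
  `exists_restrictToCompl_cupProduct_cross_eq_nsmul`, `exists_restrictToCompl_sum_cross_eq_nsmul`,
  `exists_restrictToCompl_lhSum_eq_nsmul`, `exists_restrictToCompl_eq_nsmul_of_gradedBasis`): the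
  restriction of `pr_Y^* a ⌣ pr_Z^* b` to the complex points off `pr_Y⁻¹ S ∪ pr_Z⁻¹ T` is the cup
  product of the pull-backs of `a|_{(Y∖S)(ℂ)}` and `b|_{(Z∖T)(ℂ)}` (naturality of `⌣`, Hatcher
  Prop. 3.10); hence if, term by term, either `bₗ` dies off a proper closed `Tₗ ⊊ Z` or
  `aₗ|_{(Y∖Sₗ)(ℂ)} = μ • yₗ` is divisible by `μ` off a proper closed `Sₗ ⊊ Y`, then
  `Σₗ pr_Y^* aₗ ⌣ pr_Z^* bₗ` is divisible by `μ` on the complex points of the non-empty Zariski open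
  `(Y ∖ ⋃ Sₗ) × (Z ∖ ⋃ Tₗ)` of `Y ⊗ Z` (complex points off proper closed subsets exist: Jacobson /
  Nullstellensatz; finite unions of proper closed subsets of the irreducible `Y`, `Z` are proper);
  and, with the integral Künneth expansion, EVERY class of `Hᵏ((Y ⊗ Z)(ℂ); A)` is generically
  divisible by `μ` as soon as, degree by degree, the basis class `eⱼ` dies generically on `Z` or all
  of `H^{k - d j}(Y(ℂ); A)` is generically divisible by `μ`.

Combined (the "odd-degree / product descent" of the crux `HodgeClassesGenericallyDivisible` of
route `Summits/HodgeConjecture/HodgeConjecture/Theses/GenericDivisibility`, crux-triage r2 harvest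
`PontryaginOddDescent`, product form): for `X = Y ⊗ C` a `2p`-fold with `C` a curve and
`z ∈ H²ᵖ(X(ℂ); ℤ) = Σⱼ pr_Y^* aⱼ ⌣ pr_C^* eⱼ`, the terms with `deg eⱼ = 0` (`aⱼ ∈ H²ᵖ(Y(ℂ); ℤ)`,
`2p > dim Y`: Andreotti–Frankel) and `deg eⱼ = 2` (`eⱼ` the point class, dying on `C ∖ pt`) die
generically, so generic divisibility of `z` by `m` on `X` follows from generic divisibility by `m`
of the odd Künneth coefficients `aⱼ ∈ H^{2p-1}(Y(ℂ); ℤ)` on `Y`.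

Everything is proved; no definitions, no named facts.

## References

* A. Hatcher, *Algebraic Topology* (2002), §3.1 Prop. 3.10, §3.2 Thm. 3.15, Thm. 3.16.
  [HatcherAT2002]
* B. Conrad, *Weil and Grothendieck approaches to adelic points*, Enseign. Math. 58 (2012),
  Prop. 2.1. [ConradAdelicPoints2012]
* A. Grothendieck, *Hodge's general conjecture is false for trivial reasons*, Topology 8 (1969),
  §1. [GrothendieckTopology1969]
-/

noncomputable section

open CategoryTheory AlgebraicGeometry MonoidalCategory CartesianMonoidalCategory
open Literature.AlgebraicGeometry.Motives
open Literature.AlgebraicTopology.SingularHomology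

namespace Literature.AlgebraicGeometry.HodgeTheory

variable {m n : ℕ} {Y Z : SchemeOver ℂ}

/-! ### Integral Künneth for `(Y ⊗ Z)(ℂ)` -/

section Kunneth

/-- **The Künneth theorem for `H*((Y ⊗ Z)(ℂ); A)`, bijective form, any coefficient ring** (Hatcher
Thm. 3.16 read through `(Y ⊗ Z)(ℂ) ≃ₜ Y(ℂ) × Z(ℂ)`): for `Y` smooth projective, `Z` arbitrary and
classes `eⱼ ∈ H^{d j}(Z(ℂ); A)` forming a graded basis in the Leray–Hirsch sense (the comparison map
over the one-point base is bijective), the map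
`(aⱼ) ↦ Σⱼ pr_Y^* aⱼ ⌣ pr_Z^* eⱼ : Π_{d j ≤ k} H^{k - d j}(Y(ℂ); A) → Hᵏ((Y ⊗ Z)(ℂ); A)` is bijective
for every `k`. [cite: HatcherAT2002, §3.2 Thm. 3.16] [cite: ConradAdelicPoints2012, Prop. 2.1] -/
theorem singularCohomology_lhMap_bijective_tensor (A : Type) [CommRing A]
    (hY : IsSmoothProjective m Y) {ι : Type} [Fintype ι] (d : ι → ℕ)
    (e : (j : ι) → singularCohomology A A (ComplexPoints Z) (d j))
    (he : ∀ k, Function.Bijective (LerayHirsch.lhMap A d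
      (ContinuousMap.const (ComplexPoints Z) PUnit.unit : C(ComplexPoints Z, PUnit.{1})) e k))
    (k : ℕ) :
    Function.Bijective (LerayHirsch.lhMap A d (AlgPoints.mapContinuous (L := ℂ) (fst Y Z))
      (fun j ↦ singularCohomology.map A A (AlgPoints.mapContinuous (L := ℂ) (snd Y Z)) (d j) (e j))
      k) := by
  letI := hY.chartedSpace
  haveI := ComplexPoints.compactSpace_of_isSmoothProjective hY
  haveI := ComplexPoints.t2Space_of_isSmoothProjective hY
  let T : ComplexPoints (Y ⊗ Z) ≃ₜ ComplexPoints Y × ComplexPoints Z :=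
    Homeomorph.mk AlgPoints.prodEquiv AlgPoints.continuous_prodEquiv
      AlgPoints.continuous_prodEquiv_symm
  let Tc : C(ComplexPoints (Y ⊗ Z), ComplexPoints Y × ComplexPoints Z) := T
  have hfst : (ContinuousMap.fst : C(ComplexPoints Y × ComplexPoints Z, ComplexPoints Y)).comp Tc =
      (ContinuousMap.id _).comp (AlgPoints.mapContinuous (L := ℂ) (fst Y Z)) := by
    ext P; rfl
  have hsnd : (ContinuousMap.snd : C(ComplexPoints Y × ComplexPoints Z, ComplexPoints Z)).comp Tc =
      AlgPoints.mapContinuous (L := ℂ) (snd Y Z) := by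
    ext P; rfl
  have h := (LerayHirsch.bijective_lhMap_iff A d _ _ Tc (ContinuousMap.id _) hfst
    (fun j ↦ singularCohomology.map A A
      (ContinuousMap.snd : C(ComplexPoints Y × ComplexPoints Z, ComplexPoints Z)) (d j) (e j))
    (fun i ↦ (singularCohomology.mapIso A A T i).toLinearEquiv.bijective)
    (fun i ↦ (singularCohomology.mapIso A A (Homeomorph.refl (ComplexPoints Y)) i)
      |>.toLinearEquiv.bijective) k).1
    (LerayHirsch.bijective_lhMap_fst_prod A d e (EuclideanSpace ℝ (Fin (2 * m)))
      (M := ComplexPoints Y) he k)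
  have hcls : (fun j ↦ singularCohomology.map A A Tc (d j) (singularCohomology.map A A
      (ContinuousMap.snd : C(ComplexPoints Y × ComplexPoints Z, ComplexPoints Z)) (d j) (e j))) =
      fun j ↦ singularCohomology.map A A (AlgPoints.mapContinuous (L := ℂ) (snd Y Z)) (d j) (e j) := by
    funext j
    rw [← ModuleCat.comp_apply, ← singularCohomology.map_comp, hsnd]
  rwa [hcls] at h

/-- **Künneth expansion, any coefficient ring**: under the hypotheses of
`singularCohomology_lhMap_bijective_tensor`, every class `z ∈ Hᵏ((Y ⊗ Z)(ℂ); A)` is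
`Σ_{d j ≤ k} pr_Y^* aⱼ ⌣ pr_Z^* eⱼ` for some `aⱼ ∈ H^{k - d j}(Y(ℂ); A)`.
[cite: HatcherAT2002, §3.2 Thm. 3.16] -/
theorem exists_eq_sum_cross_tensor (A : Type) [CommRing A]
    (hY : IsSmoothProjective m Y) {ι : Type} [Fintype ι] (d : ι → ℕ)
    (e : (j : ι) → singularCohomology A A (ComplexPoints Z) (d j))
    (he : ∀ k, Function.Bijective (LerayHirsch.lhMap A d
      (ContinuousMap.const (ComplexPoints Z) PUnit.unit : C(ComplexPoints Z, PUnit.{1})) e k))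
    (k : ℕ) (z : singularCohomology A A (ComplexPoints (Y ⊗ Z)) k) :
    ∃ a : LerayHirsch.Src A d (ComplexPoints Y) k, z = ∑ j : ι, if h : d j ≤ k then
      cupProduct (Nat.sub_add_cancel h)
        (singularCohomology.map A A (AlgPoints.mapContinuous (L := ℂ) (fst Y Z)) (k - d j) (a ⟨j, h⟩))
        (singularCohomology.map A A (AlgPoints.mapContinuous (L := ℂ) (snd Y Z)) (d j) (e j))
      else 0 := by
  obtain ⟨a, ha⟩ := (singularCohomology_lhMap_bijective_tensor A hY d e he k).2 z
  exact ⟨a, by rw [← ha, LerayHirsch.lhMap_apply]⟩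

end Kunneth

/-! ### Restricting cross products to product opens -/

section Restriction

variable (A : Type) [CommRing A]

/-- **Restriction of a cross product to a product open.** For `S ⊆ Y`, `T ⊆ Z` and
`D = pr_Y⁻¹ S ∪ pr_Z⁻¹ T ⊆ Y ⊗ Z`, whose complement has complex points `(Y ∖ S)(ℂ) × (Z ∖ T)(ℂ)`:
`(pr_Y^* a ⌣ pr_Z^* b)|_{((Y ⊗ Z) ∖ D)(ℂ)} = q_Y^* (a|_{(Y∖S)(ℂ)}) ⌣ q_Z^* (b|_{(Z∖T)(ℂ)})` for the two
projections `q_Y`, `q_Z` of `((Y ⊗ Z) ∖ D)(ℂ)` to `(Y ∖ S)(ℂ)`, `(Z ∖ T)(ℂ)` (naturality of the cup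
product and functoriality of `Hᵏ`, Hatcher Prop. 3.10). [cite: HatcherAT2002, §3.1 Prop. 3.10]
[cite: GrothendieckTopology1969, §1] -/
theorem restrictToCompl_cupProduct_cross (S : Set Y.left) (T : Set Z.left) {i j k : ℕ}
    (h : i + j = k) (a : singularCohomology A A (ComplexPoints Y) i)
    (b : singularCohomology A A (ComplexPoints Z) j) :
    restrictToCompl A (Y ⊗ Z) k ((fst Y Z).left.base ⁻¹' S ∪ (snd Y Z).left.base ⁻¹' T)
        (cupProduct h
          (singularCohomology.map A A (AlgPoints.mapContinuous (L := ℂ) (fst Y Z)) i a)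
          (singularCohomology.map A A (AlgPoints.mapContinuous (L := ℂ) (snd Y Z)) j b)) =
      cupProduct h
        (singularCohomology.map A A
          (⟨fun R : complexPointsCompl (Y ⊗ Z)
              ((fst Y Z).left.base ⁻¹' S ∪ (snd Y Z).left.base ⁻¹' T) ↦
              (⟨AlgPoints.mapContinuous (L := ℂ) (fst Y Z) R.1, fun hR ↦ R.2 (Or.inl hR)⟩ :
                complexPointsCompl Y S),
            ((AlgPoints.continuous_map (fst Y Z)).comp continuous_subtype_val).subtype_mk
              fun (R : complexPointsCompl (Y ⊗ Z)
                  ((fst Y Z).left.base ⁻¹' S ∪ (snd Y Z).left.base ⁻¹' T))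
                (hR : (AlgPoints.map (fst Y Z) R.1).pt ∈ S) ↦ R.2 (Or.inl hR)⟩ :
            C(complexPointsCompl (Y ⊗ Z) ((fst Y Z).left.base ⁻¹' S ∪ (snd Y Z).left.base ⁻¹' T),
              complexPointsCompl Y S)) i
          (restrictToCompl A Y i S a))
        (singularCohomology.map A A
          (⟨fun R : complexPointsCompl (Y ⊗ Z)
              ((fst Y Z).left.base ⁻¹' S ∪ (snd Y Z).left.base ⁻¹' T) ↦
              (⟨AlgPoints.mapContinuous (L := ℂ) (snd Y Z) R.1, fun hR ↦ R.2 (Or.inr hR)⟩ :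
                complexPointsCompl Z T),
            ((AlgPoints.continuous_map (snd Y Z)).comp continuous_subtype_val).subtype_mk
              fun (R : complexPointsCompl (Y ⊗ Z)
                  ((fst Y Z).left.base ⁻¹' S ∪ (snd Y Z).left.base ⁻¹' T))
                (hR : (AlgPoints.map (snd Y Z) R.1).pt ∈ T) ↦ R.2 (Or.inr hR)⟩ :
            C(complexPointsCompl (Y ⊗ Z) ((fst Y Z).left.base ⁻¹' S ∪ (snd Y Z).left.base ⁻¹' T),
              complexPointsCompl Z T)) j
          (restrictToCompl A Z j T b)) := by
  change singularCohomology.map A A _ k _ = _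
  rw [cupProduct_map]
  change cupProduct h (singularCohomology.map A A _ i (singularCohomology.map A A _ i a))
      (singularCohomology.map A A _ j (singularCohomology.map A A _ j b)) =
    cupProduct h (singularCohomology.map A A _ i (singularCohomology.map A A _ i a))
      (singularCohomology.map A A _ j (singularCohomology.map A A _ j b))
  rw [← ModuleCat.comp_apply, ← singularCohomology.map_comp, ← ModuleCat.comp_apply,
    ← singularCohomology.map_comp, ← ModuleCat.comp_apply, ← singularCohomology.map_comp,
    ← ModuleCat.comp_apply, ← singularCohomology.map_comp]
  rfl

/-- The union `pr_Y⁻¹ S ∪ pr_Z⁻¹ T` of the preimages of PROPER Zariski-closed subsets `S ⊊ Y`,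
`T ⊊ Z` of smooth projective `Y`, `Z` is a proper closed subset of `Y ⊗ Z`: a complex point `P` of
`Y` off `S` and `Q` of `Z` off `T` exist (closed points are dense: Jacobson / Nullstellensatz), and
the complex point `(P, Q)` of `Y ⊗ Z` lies off the union. [cite: ConradAdelicPoints2012, Prop. 2.1]
[cite: GrothendieckTopology1969, §1] -/
theorem preimage_fst_union_preimage_snd_ne_univ (hY : IsSmoothProjective m Y)
    (hZ : IsSmoothProjective n Z) {S : Set Y.left} {T : Set Z.left} (hS : IsClosed S)
    (hSne : S ≠ Set.univ) (hT : IsClosed T) (hTne : T ≠ Set.univ) :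
    IsClosed ((fst Y Z).left.base ⁻¹' S ∪ (snd Y Z).left.base ⁻¹' T) ∧
      ((fst Y Z).left.base ⁻¹' S ∪ (snd Y Z).left.base ⁻¹' T) ≠ Set.univ := by
  refine ⟨(hS.preimage (fst Y Z).left.base.hom.continuous).union
    (hT.preimage (snd Y Z).left.base.hom.continuous), fun hD ↦ ?_⟩
  -- complex points off a proper closed subset of a `ℂ`-scheme locally of finite type
  have key : ∀ {W : SchemeOver ℂ} [LocallyOfFiniteType W.hom] {C : Set W.left}, IsClosed C →
      C ≠ Set.univ → ∃ P : ComplexPoints W, P.pt ∉ C := by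
    intro W _ C hC hCne
    haveI : JacobsonSpace ↥W.left := LocallyOfFiniteType.jacobsonSpace W.hom
    obtain ⟨x, hxC, hxc⟩ := nonempty_inter_closedPoints (X := ↥W.left)
      (Set.nonempty_compl.mpr hCne) hC.isOpen_compl.isLocallyClosed
    refine ⟨(ComplexPoints.equivClosedPoints W).symm ⟨x, hxc⟩, ?_⟩
    have hpt : ((ComplexPoints.equivClosedPoints W).symm ⟨x, hxc⟩).pt = x := by
      have := ComplexPoints.coe_equivClosedPoints_apply W
        ((ComplexPoints.equivClosedPoints W).symm ⟨x, hxc⟩)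
      rw [Equiv.apply_symm_apply] at this
      exact this.symm
    rw [hpt]
    exact hxC
  haveI : IsProper Y.hom := IsSmoothProjective.isProper_holds hY
  haveI : IsProper Z.hom := IsSmoothProjective.isProper_holds hZ
  obtain ⟨P, hP⟩ := key hS hSne
  obtain ⟨Q, hQ⟩ := key hT hTne
  have hR : (AlgPoints.prodEquiv.symm (P, Q) : ComplexPoints (Y ⊗ Z)).pt ∈
      ((fst Y Z).left.base ⁻¹' S ∪ (snd Y Z).left.base ⁻¹' T) := hD ▸ Set.mem_univ _
  rcases hR with h | h
  · refine hP ?_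
    have e : (AlgPoints.map (fst Y Z) (AlgPoints.prodEquiv.symm (P, Q))).pt ∈ S := h
    rwa [← AlgPoints.prodEquiv_apply_fst, Equiv.apply_symm_apply] at e
  · refine hQ ?_
    have e : (AlgPoints.map (snd Y Z) (AlgPoints.prodEquiv.symm (P, Q))).pt ∈ T := h
    rwa [← AlgPoints.prodEquiv_apply_snd, Equiv.apply_symm_apply] at e

/-- In an irreducible space a finite union of proper closed subsets is a proper closed subset
(two closed sets covering an irreducible space cannot both be proper). [folklore] -/
theorem isClosed_iUnion_and_iUnion_ne_univ {α ι : Type*} [TopologicalSpace α] [IrreducibleSpace α]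
    [Finite ι] (C : ι → Set α) (hC : ∀ l, IsClosed (C l)) (hCne : ∀ l, C l ≠ Set.univ) :
    IsClosed (⋃ l, C l) ∧ (⋃ l, C l) ≠ Set.univ := by
  classical
  haveI := Fintype.ofFinite ι
  refine ⟨isClosed_iUnion_of_finite hC, ?_⟩
  have hirr := (IrreducibleSpace.isIrreducible_univ α).isPreirreducible
  have step : ∀ s : Finset ι, (⋃ l ∈ s, C l) ≠ Set.univ := by
    intro s
    induction s using Finset.induction_on with
    | empty =>
      intro hU
      simp only [Finset.notMem_empty, Set.iUnion_of_empty, Set.iUnion_empty] at hU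
      exact Set.empty_ne_univ hU
    | insert l s hls ih =>
      intro hU
      rw [Finset.set_biUnion_insert] at hU
      have hcl : IsClosed (⋃ l' ∈ s, C l') :=
        (s.finite_toSet).isClosed_biUnion fun l' _ ↦ hC l'
      rcases (isPreirreducible_iff_isClosed_union_isClosed.1 hirr) (C l) (⋃ l' ∈ s, C l')
        (hC l) hcl hU.symm.subset with h1 | h1
      · exact hCne l (Set.eq_univ_of_univ_subset h1)
      · exact ih (Set.eq_univ_of_univ_subset h1)
  have e : (⋃ l, C l) = ⋃ l ∈ (Finset.univ : Finset ι), C l := by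
    simp only [Finset.mem_univ, Set.iUnion_true]
  rw [e]
  exact step Finset.univ

/-- **One cross term.** If `b` dies on `(Z ∖ T₀)(ℂ)` or `a|_{(Y ∖ S₀)(ℂ)} = μ • y`, then for all
`S ⊇ S₀`, `T ⊇ T₀` the cross product `pr_Y^* a ⌣ pr_Z^* b` is divisible by `μ` on the complex points
off `pr_Y⁻¹ S ∪ pr_Z⁻¹ T` (`restrictToCompl_cupProduct_cross` and bilinearity of `⌣`).
[cite: HatcherAT2002, §3.1 Prop. 3.10] [cite: GrothendieckTopology1969, §1] -/
theorem exists_restrictToCompl_cupProduct_cross_eq_nsmul {S₀ S : Set Y.left} {T₀ T : Set Z.left}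
    (hS : S₀ ⊆ S) (hT : T₀ ⊆ T) {i j k : ℕ} (h : i + j = k)
    (a : singularCohomology A A (ComplexPoints Y) i) (b : singularCohomology A A (ComplexPoints Z) j)
    (μ : ℕ) (hab : restrictToCompl A Z j T₀ b = 0 ∨
      ∃ y : singularCohomology A A (complexPointsCompl Y S₀) i, restrictToCompl A Y i S₀ a = μ • y) :
    ∃ w : singularCohomology A A (complexPointsCompl (Y ⊗ Z)
        ((fst Y Z).left.base ⁻¹' S ∪ (snd Y Z).left.base ⁻¹' T)) k,
      restrictToCompl A (Y ⊗ Z) k ((fst Y Z).left.base ⁻¹' S ∪ (snd Y Z).left.base ⁻¹' T)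
          (cupProduct h
            (singularCohomology.map A A (AlgPoints.mapContinuous (L := ℂ) (fst Y Z)) i a)
            (singularCohomology.map A A (AlgPoints.mapContinuous (L := ℂ) (snd Y Z)) j b)) =
        μ • w := by
  rw [restrictToCompl_cupProduct_cross]
  rcases hab with hb | ⟨y, hy⟩
  · -- `b` dies off `T₀ ⊆ T`
    have hb' : restrictToCompl A Z j T b = 0 := restrictToCompl_eq_zero_of_subset A Z j hT hb
    refine ⟨0, ?_⟩
    rw [hb', map_zero, map_zero, nsmul_zero]
  · -- `a` is divisible by `μ` off `S₀ ⊆ S`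
    have hc : restrictToCompl A Y i S =
        restrictToCompl A Y i S₀ ≫
          singularCohomology.map A A (complexPointsComplInclusion hS) i :=
      singularCohomology.map_comp A A (complexPointsComplInclusion hS)
        (⟨Subtype.val, continuous_subtype_val⟩ : C(complexPointsCompl Y S₀, ComplexPoints Y)) i
    have ha' : restrictToCompl A Y i S a =
        μ • singularCohomology.map A A (complexPointsComplInclusion hS) i y := by
      rw [hc, ModuleCat.comp_apply, hy, map_nsmul]
    rw [ha', map_nsmul]
    have key : ∀ {E : Type} [TopologicalSpace E] (x : singularCohomology A A E i)
        (w' : singularCohomology A A E j),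
        cupProduct h (μ • x) w' = μ • cupProduct h x w' := fun x w' ↦ by
      simpa only [LinearMap.flip_apply] using map_nsmul ((cupProduct h).flip w') μ x
    exact ⟨_, key _ _⟩

/-- **Product descent of generic divisibility.** Let `Y`, `Z` be smooth projective over `ℂ`,
`z = Σₗ pr_Y^* aₗ ⌣ pr_Z^* bₗ ∈ Hᵏ((Y ⊗ Z)(ℂ); A)` a finite sum of cross products
(`aₗ ∈ H^{iₗ}(Y(ℂ); A)`, `bₗ ∈ H^{jₗ}(Z(ℂ); A)`, `iₗ + jₗ = k`), `μ ∈ ℕ`, and suppose that for every `l`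
EITHER `bₗ` dies on `(Z ∖ Tₗ)(ℂ)` OR `aₗ|_{(Y ∖ Sₗ)(ℂ)} = μ • yₗ` is divisible by `μ` there, for proper
Zariski-closed `Sₗ ⊊ Y`, `Tₗ ⊊ Z`. Then `z` is divisible by `μ` on the complex points of the proper
Zariski-closed complement `D = pr_Y⁻¹(⋃ Sₗ) ∪ pr_Z⁻¹(⋃ Tₗ)`: `z|_{((Y ⊗ Z) ∖ D)(ℂ)} = μ • w`.
[cite: HatcherAT2002, §3.1 Prop. 3.10] [cite: GrothendieckTopology1969, §1] -/
theorem exists_restrictToCompl_sum_cross_eq_nsmul (hY : IsSmoothProjective m Y)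
    (hZ : IsSmoothProjective n Z) {ι : Type} [Fintype ι] {k : ℕ} (i j : ι → ℕ)
    (h : ∀ l, i l + j l = k) (a : (l : ι) → singularCohomology A A (ComplexPoints Y) (i l))
    (b : (l : ι) → singularCohomology A A (ComplexPoints Z) (j l)) (μ : ℕ)
    (S : ι → Set Y.left) (T : ι → Set Z.left) (hS : ∀ l, IsClosed (S l))
    (hSne : ∀ l, S l ≠ Set.univ) (hT : ∀ l, IsClosed (T l)) (hTne : ∀ l, T l ≠ Set.univ)
    (hab : ∀ l, restrictToCompl A Z (j l) (T l) (b l) = 0 ∨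
      ∃ y : singularCohomology A A (complexPointsCompl Y (S l)) (i l),
        restrictToCompl A Y (i l) (S l) (a l) = μ • y) :
    IsClosed ((fst Y Z).left.base ⁻¹' (⋃ l, S l) ∪ (snd Y Z).left.base ⁻¹' (⋃ l, T l)) ∧
      ((fst Y Z).left.base ⁻¹' (⋃ l, S l) ∪ (snd Y Z).left.base ⁻¹' (⋃ l, T l)) ≠ Set.univ ∧
      ∃ w : singularCohomology A A (complexPointsCompl (Y ⊗ Z)
          ((fst Y Z).left.base ⁻¹' (⋃ l, S l) ∪ (snd Y Z).left.base ⁻¹' (⋃ l, T l))) k,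
        restrictToCompl A (Y ⊗ Z) k
            ((fst Y Z).left.base ⁻¹' (⋃ l, S l) ∪ (snd Y Z).left.base ⁻¹' (⋃ l, T l))
            (∑ l, cupProduct (h l)
              (singularCohomology.map A A (AlgPoints.mapContinuous (L := ℂ) (fst Y Z)) (i l) (a l))
              (singularCohomology.map A A (AlgPoints.mapContinuous (L := ℂ) (snd Y Z)) (j l) (b l))) =
          μ • w := by
  haveI := IsSmoothProjective.isIntegral_holds hY
  haveI := IsSmoothProjective.isIntegral_holds hZ
  obtain ⟨hSc, hSu⟩ := isClosed_iUnion_and_iUnion_ne_univ S hS hSne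
  obtain ⟨hTc, hTu⟩ := isClosed_iUnion_and_iUnion_ne_univ T hT hTne
  obtain ⟨hDc, hDne⟩ := preimage_fst_union_preimage_snd_ne_univ hY hZ hSc hSu hTc hTu
  refine ⟨hDc, hDne, ?_⟩
  choose w hw using fun l ↦ exists_restrictToCompl_cupProduct_cross_eq_nsmul A
    (Set.subset_iUnion S l) (Set.subset_iUnion T l) (h l) (a l) (b l) μ (hab l)
  refine ⟨∑ l, w l, ?_⟩
  rw [map_sum, Finset.smul_sum]
  exact Finset.sum_congr rfl fun l _ ↦ hw l

/-- **Product descent of generic divisibility, Künneth-indexed form.** For the expansion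
`z = Σ_{d j ≤ k} pr_Y^* aⱼ ⌣ pr_Z^* eⱼ` of a class of `Hᵏ((Y ⊗ Z)(ℂ); A)` along classes
`eⱼ ∈ H^{d j}(Z(ℂ); A)` (as produced by `exists_eq_sum_cross_tensor`) and `μ ∈ ℕ`: if for every `j`
with `d j ≤ k` EITHER `eⱼ` dies on the complex points of a non-empty Zariski open of `Z` OR the
coefficient `aⱼ ∈ H^{k - d j}(Y(ℂ); A)` is divisible by `μ` on the complex points of a non-empty
Zariski open of `Y`, then `z` is divisible by `μ` on the complex points of a non-empty Zariski open of
`Y ⊗ Z`. (For `Z` a curve with `H*(Z(ℂ); ℤ)` free: the degree-`0` and degree-`2` terms are disposed of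
by Andreotti–Frankel on `Y` and on `Z ∖ pt`, leaving the generic divisibility of the odd Künneth
coefficients `aⱼ ∈ H^{k-1}(Y(ℂ); ℤ)` — the product form of the odd-degree descent of the crux
`HodgeClassesGenericallyDivisible`.) [cite: HatcherAT2002, §3.1 Prop. 3.10 and §3.2 Thm. 3.16]
[cite: GrothendieckTopology1969, §1] -/
theorem exists_restrictToCompl_lhSum_eq_nsmul (hY : IsSmoothProjective m Y)
    (hZ : IsSmoothProjective n Z) {ι : Type} [Fintype ι] (d : ι → ℕ)
    (e : (j : ι) → singularCohomology A A (ComplexPoints Z) (d j)) {k : ℕ}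
    (a : LerayHirsch.Src A d (ComplexPoints Y) k) (μ : ℕ)
    (hyp : ∀ (j : ι) (hj : d j ≤ k),
      (∃ T : Set Z.left, IsClosed T ∧ T ≠ Set.univ ∧ restrictToCompl A Z (d j) T (e j) = 0) ∨
      (∃ S : Set Y.left, IsClosed S ∧ S ≠ Set.univ ∧
        ∃ y : singularCohomology A A (complexPointsCompl Y S) (k - d j),
          restrictToCompl A Y (k - d j) S (a ⟨j, hj⟩) = μ • y)) :
    ∃ D : Set (Y ⊗ Z).left, IsClosed D ∧ D ≠ Set.univ ∧
      ∃ w : singularCohomology A A (complexPointsCompl (Y ⊗ Z) D) k,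
        restrictToCompl A (Y ⊗ Z) k D (∑ j : ι, if hj : d j ≤ k then
          cupProduct (Nat.sub_add_cancel hj)
            (singularCohomology.map A A (AlgPoints.mapContinuous (L := ℂ) (fst Y Z)) (k - d j)
              (a ⟨j, hj⟩))
            (singularCohomology.map A A (AlgPoints.mapContinuous (L := ℂ) (snd Y Z)) (d j) (e j))
          else 0) = μ • w := by
  classical
  haveI := IsSmoothProjective.isIntegral_holds hY
  haveI := IsSmoothProjective.isIntegral_holds hZ
  -- uniform data: closed proper `S j ⊆ Y`, `T j ⊆ Z` for every index (`∅` where nothing is asked)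
  have data : ∀ j : ι, ∃ (S : Set Y.left) (T : Set Z.left), IsClosed S ∧ S ≠ Set.univ ∧
      IsClosed T ∧ T ≠ Set.univ ∧ ∀ hj : d j ≤ k,
        restrictToCompl A Z (d j) T (e j) = 0 ∨
          ∃ y : singularCohomology A A (complexPointsCompl Y S) (k - d j),
            restrictToCompl A Y (k - d j) S (a ⟨j, hj⟩) = μ • y := by
    intro j
    by_cases hj : d j ≤ k
    · rcases hyp j hj with ⟨T, hT, hTne, hb⟩ | ⟨S, hS, hSne, y, hy⟩
      · exact ⟨∅, T, isClosed_empty, Set.empty_ne_univ, hT, hTne, fun _ ↦ Or.inl hb⟩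
      · exact ⟨S, ∅, hS, hSne, isClosed_empty, Set.empty_ne_univ, fun _ ↦ Or.inr ⟨y, hy⟩⟩
    · exact ⟨∅, ∅, isClosed_empty, Set.empty_ne_univ, isClosed_empty, Set.empty_ne_univ,
        fun hj' ↦ absurd hj' hj⟩
  choose S T hS hSne hT hTne hab using data
  obtain ⟨hSc, hSu⟩ := isClosed_iUnion_and_iUnion_ne_univ S hS hSne
  obtain ⟨hTc, hTu⟩ := isClosed_iUnion_and_iUnion_ne_univ T hT hTne
  obtain ⟨hDc, hDne⟩ := preimage_fst_union_preimage_snd_ne_univ hY hZ hSc hSu hTc hTu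
  refine ⟨_, hDc, hDne, ?_⟩
  -- term by term
  have hterm : ∀ j : ι, ∃ w : singularCohomology A A (complexPointsCompl (Y ⊗ Z)
      ((fst Y Z).left.base ⁻¹' (⋃ l, S l) ∪ (snd Y Z).left.base ⁻¹' (⋃ l, T l))) k,
      restrictToCompl A (Y ⊗ Z) k
          ((fst Y Z).left.base ⁻¹' (⋃ l, S l) ∪ (snd Y Z).left.base ⁻¹' (⋃ l, T l))
          (if hj : d j ≤ k then
            cupProduct (Nat.sub_add_cancel hj)
              (singularCohomology.map A A (AlgPoints.mapContinuous (L := ℂ) (fst Y Z)) (k - d j)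
                (a ⟨j, hj⟩))
              (singularCohomology.map A A (AlgPoints.mapContinuous (L := ℂ) (snd Y Z)) (d j) (e j))
          else 0) = μ • w := by
    intro j
    by_cases hj : d j ≤ k
    · rw [dif_pos hj]
      exact exists_restrictToCompl_cupProduct_cross_eq_nsmul A (Set.subset_iUnion S j)
        (Set.subset_iUnion T j) (Nat.sub_add_cancel hj) (a ⟨j, hj⟩) (e j) μ (hab j hj)
    · refine ⟨0, ?_⟩
      rw [dif_neg hj, map_zero, nsmul_zero]
  choose w hw using hterm
  refine ⟨∑ j, w j, ?_⟩
  rw [map_sum, Finset.smul_sum]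
  exact Finset.sum_congr rfl fun j _ ↦ hw j

/-- **Product descent of generic divisibility for `Hᵏ((Y ⊗ Z)(ℂ); A)`** (the form consumed by a
descent line on the crux `HodgeClassesGenericallyDivisible`): let `Y`, `Z` be smooth projective over
`ℂ`, `eⱼ ∈ H^{d j}(Z(ℂ); A)` a graded basis in the Leray–Hirsch sense (integral Künneth,
`exists_eq_sum_cross_tensor`), `μ ∈ ℕ`. If for every degree index `j` with `d j ≤ k` EITHER `eⱼ` dies on
the complex points of a non-empty Zariski open of `Z` OR every class of `H^{k - d j}(Y(ℂ); A)` is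
divisible by `μ` on the complex points of a non-empty Zariski open of `Y`, then EVERY class of
`Hᵏ((Y ⊗ Z)(ℂ); A)` is divisible by `μ` on the complex points of a non-empty Zariski open of `Y ⊗ Z`.
[cite: HatcherAT2002, §3.1 Prop. 3.10 and §3.2 Thm. 3.16] [cite: GrothendieckTopology1969, §1] -/
theorem exists_restrictToCompl_eq_nsmul_of_gradedBasis (hY : IsSmoothProjective m Y)
    (hZ : IsSmoothProjective n Z) {ι : Type} [Fintype ι] (d : ι → ℕ)
    (e : (j : ι) → singularCohomology A A (ComplexPoints Z) (d j))
    (he : ∀ k, Function.Bijective (LerayHirsch.lhMap A d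
      (ContinuousMap.const (ComplexPoints Z) PUnit.unit : C(ComplexPoints Z, PUnit.{1})) e k))
    {k : ℕ} (μ : ℕ)
    (hyp : ∀ j : ι, d j ≤ k →
      (∃ T : Set Z.left, IsClosed T ∧ T ≠ Set.univ ∧ restrictToCompl A Z (d j) T (e j) = 0) ∨
      (∀ x : singularCohomology A A (ComplexPoints Y) (k - d j),
        ∃ S : Set Y.left, IsClosed S ∧ S ≠ Set.univ ∧
          ∃ y : singularCohomology A A (complexPointsCompl Y S) (k - d j),
            restrictToCompl A Y (k - d j) S x = μ • y))
    (z : singularCohomology A A (ComplexPoints (Y ⊗ Z)) k) :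
    ∃ D : Set (Y ⊗ Z).left, IsClosed D ∧ D ≠ Set.univ ∧
      ∃ w : singularCohomology A A (complexPointsCompl (Y ⊗ Z) D) k,
        restrictToCompl A (Y ⊗ Z) k D z = μ • w := by
  obtain ⟨a, rfl⟩ := exists_eq_sum_cross_tensor A hY d e he k z
  refine exists_restrictToCompl_lhSum_eq_nsmul A hY hZ d e a μ fun j hj ↦ ?_
  rcases hyp j hj with hT | hS
  · exact Or.inl hT
  · exact Or.inr (hS (a ⟨j, hj⟩))

end Restriction

end Literature.AlgebraicGeometry.HodgeTheory

end
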